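import Literature.NumberTheory.DiophantineGeometry.GeneralizedFermatTwoPowerCoefficientFreySwanEightProofs
import Literature.NumberTheory.EllipticCurves.ThreeTorsionSwanAtTwoClassD6C4C7M8R7M2R1Proofs
import Literature.NumberTheory.EllipticCurves.ThreeTorsionSwanAtTwoClassD6C4Cge8M8R3Proofs
import Literature.NumberTheory.EllipticCurves.HasseWeilAbelianConductorSwanIndependenceTwoProofs
import Literature.NumberTheory.EllipticCurves.SwanConductorTorsionProofs
import Literature.NumberTheory.EllipticCurves.TateModuleContinuityProofs
import HarnessLib

/-!
# Crux `FreyModularity` (stmt-ABC-11340), line `Sketch`: the stub `stub_freySwanOdd`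
# (Diamond–Kramer 1995, Lemma 2: the Swan conductor of `E[5]` above `2` is odd on the additive Frey classes) — proved

The registered stub `stub_freySwanOdd` of the line `Sketch` of the crux
`Summit.ABC.ABC.Theses.DefiniteXi.FreyModularity`: **for coprime `A, B` with `AB(A+B) ≠ 0`,
`A ≡ −1 (mod 4)`, `2 ∣ B`, `16 ∤ B` and `2A + B ≠ 0`, there is a prime `𝔓` of `\bar ℤ` above `2` at
which the Swan conductor of the `5`-torsion `E[5]` of the Frey curve
`E = E_(A,B) = freyCurve A B : y² = x (x − A) (x + B)` is `1` or `3`** — in particular ODD.  This is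
the Galois side of Diamond–Kramer's `2`-adic table (F. Diamond, K. Kramer, *Modularity of a family of
elliptic curves*, Math. Res. Lett. **2** (1995), Lemma 2: for `ord₂ B = 1, 2, 3` the normalised Frey
curve is additive at `2` with `f₂ = 5, 3, 3`, i.e. `δ₂ = Sw = 3, 1, 1`), assembled from theorems of
the tree:

* `swanConductorAt_torsion_five_eq_swanConductorAt_torsion_three` — **`Sw_𝔓(E[5]) = Sw_𝔓(E[3])`
  at every prime `𝔓 ∣ 2`** for every elliptic curve `E/ℚ`: both equal the Swan conductor of the
  `ℓ`-adic representation `V_ℓ E` (`swanConductorAt_rationalTate_eq_swanConductorAt_torsion`,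
  Silverman *ATAEC* §IV.10, for `ℓ = 5` and `ℓ = 3`, neither of which lies in a place above `2`),
  and `Sw_𝔓(V_5 E) = Sw_𝔓(V_3 E)` (`swanConductorAt_rationalTate_eq_swanConductorAt_rationalTate`,
  *ATAEC* Thm. IV.10.2(c), valid at the places above `2`);
* `freyCurve_c₄_eq`, `freyCurve_c₆_eq` — `c₄ = 16(A² + AB + B²)`,
  `c₆ = −32(B − A)(2A + B)(A + 2B)` for the Frey model (Silverman *AEC* III.1);
* `swanConductorAt_torsion_three_freyCurve_of_two_mul` — **`Sw_𝔓(E[3]) = 3` for `2 ∥ B`**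
  (`A = 4α − 1`, `B = 2b`, `b` odd, `2A + B ≠ 0`): the Frey model lies in the `2`-adic class
  `(ord₂ Δ, ord₂ c₄, ord₂ c₆) = (6, 4, 7)` with `c₄' ≡ 7 (mod 8)`, `c₆'` odd when `b ≡ 3 (mod 4)`
  (tree: `swanConductorAt_torsion_three_of_class_D6C4C7M8R7M2R1`), and in the class `(6, 4, ≥ 8)`
  with `c₄' ≡ 3 (mod 8)`, `c₆/2⁸ ≠ 0` when `b ≡ 1 (mod 4)` (here `2A + B = 8(α + γ)`, `b = 4γ + 1`,
  so `c₆ ≠ 0` is exactly `2A + B ≠ 0`; tree: `swanConductorAt_torsion_three_of_class_D6C4Cge8M8R3`)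
  — the fake-point computations of the Galois side of Ogg's formula at `2`, *ATAEC* Thm. IV.11.1;
  Diamond–Kramer: `f₂ = 5`;
* `stub_freySwanOdd` — at the place `v₂ = primesEquiv.symm 2` of `𝓞 ℚ`: if `4 ∣ B` the tree's
  `exists_swanConductorAt_torsion_three_freyCurve_of_sixteen_not_dvd` (`4 ∥ B`: class `(8,4,6)` by the
  `2`-isogeny onto `(4,5,5)`; `8 ∥ B`: class `(10,4,6)`) gives `Sw_𝔓(E[3]) = 1` at some `𝔓 ∣ v₂`;
  if `2 ∥ B` the previous item gives `Sw_𝔓(E[3]) = 3` at every `𝔓 ∣ v₂`; transport to `E[5]`.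

The excluded curve `2A + B = 0` is `E_(−1,2) : y² = x³ − x` (`c₆ = 0`, `j = 1728`), handled by the
lead's glue stub; coprimality is not used.

## References

* [DiamondKramer1995] F. Diamond, K. Kramer, *Modularity of a family of elliptic curves*,
  Math. Res. Lett. 2 (1995), no. 3, 299–304, Lemmas 1–2.
* [SilvermanATAEC1994] J. H. Silverman, *Advanced Topics in the Arithmetic of Elliptic Curves*,
  GTM 151 (1994), §IV.10 (PDF p. 358), Thm. IV.10.2(c), Thm. IV.11.1.
* [SilvermanAEC2009] J. H. Silverman, *The Arithmetic of Elliptic Curves*, 2nd ed. (2009), III.1.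
-/

-- `Summit.<Summit>.<Problem>` is the mandated summit-side namespace (CONVENTIONS §2); for the
-- single-conjunct summit `ABC` the two coincide, so the duplicate `ABC.ABC` is deliberate.
set_option linter.dupNamespace false

noncomputable section

open scoped NumberField

open Field IsDedekindDomain
open Literature.NumberTheory.EllipticCurves
open Literature.NumberTheory.GaloisRepresentations
open Literature.NumberTheory.DiophantineGeometry
open WeierstrassCurve

namespace Summit.ABC.ABC.Theorems

-- `E[n]` as an `𝔽_n`-module (needed to speak of `W.torsionGaloisRep n`, as in the tree's Swan files).
attribute [local instance] AddSubgroup.torsionBy.zmodModule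

/-! ## `Sw_𝔓(E[5]) = Sw_𝔓(E[3])` above `2` -/

/-- `5 ∉ v` for a place `v ∋ 2` of `𝓞 ℚ` (`1 = 5 − 2·2`). [folklore] -/
theorem five_notMem_of_two_mem {v : HeightOneSpectrum (𝓞 ℚ)} (hv2 : (2 : 𝓞 ℚ) ∈ v.asIdeal) :
    ((5 : ℕ) : 𝓞 ℚ) ∉ v.asIdeal := by
  intro h5v
  have h1 : (1 : 𝓞 ℚ) ∈ v.asIdeal := by
    have e : (1 : 𝓞 ℚ) = ((5 : ℕ) : 𝓞 ℚ) - 2 * 2 := by norm_num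
    rw [e]; exact Ideal.sub_mem _ h5v (Ideal.mul_mem_left _ _ hv2)
  exact v.isPrime.ne_top ((Ideal.eq_top_iff_one _).mpr h1)

/-- **`Sw_𝔓(E[5]) = Sw_𝔓(E[3])` at every prime `𝔓` of `\bar ℤ` above `2`**, for every elliptic
curve `E/ℚ`: `Sw_𝔓(E[ℓ]) = Sw_𝔓(V_ℓ E)` for `ℓ = 3, 5` (Silverman *ATAEC* §IV.10, PDF p. 358: `δ`
is defined through `E[ℓ]`; tree `swanConductorAt_rationalTate_eq_swanConductorAt_torsion` with the
continuity witnesses `continuous_rationalGaloisRepTate_holds`), and `Sw_𝔓(V_5 E) = Sw_𝔓(V_3 E)`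
(*ATAEC* Thm. IV.10.2(c), "independent of the choice of `ℓ`"; tree
`swanConductorAt_rationalTate_eq_swanConductorAt_rationalTate`, valid above `2`).
[cite: SilvermanATAEC1994, Thm. IV.10.2(c) (PDF p. 358) with §IV.10 Definition of δ(E/K)] -/
theorem swanConductorAt_torsion_five_eq_swanConductorAt_torsion_three (W : WeierstrassCurve ℚ)
    [W.IsElliptic] {v : HeightOneSpectrum (𝓞 ℚ)} (hv2 : (2 : 𝓞 ℚ) ∈ v.asIdeal)
    {𝔓 : Ideal (absIntegers (𝓞 ℚ) ℚ)} (h𝔓 : 𝔓 ∈ v.primesAbove) :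
    (W.torsionGaloisRep 5).swanConductorAt (𝓞 ℚ) 𝔓 =
      (W.torsionGaloisRep 3).swanConductorAt (𝓞 ℚ) 𝔓 := by
  haveI : Fact (Nat.Prime 5) := ⟨Nat.prime_five⟩
  haveI : Fact (Nat.Prime 3) := ⟨Nat.prime_three⟩
  have h3 : ((3 : ℕ) : 𝓞 ℚ) ∉ v.asIdeal := Ribet1997.three_notMem_of_two_mem hv2
  have h5 : ((5 : ℕ) : 𝓞 ℚ) ∉ v.asIdeal := five_notMem_of_two_mem hv2
  rw [← W.swanConductorAt_rationalTate_eq_swanConductorAt_torsion 5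
      (W.continuous_rationalGaloisRepTate_holds 5) h5 h𝔓,
    ← W.swanConductorAt_rationalTate_eq_swanConductorAt_torsion 3
      (W.continuous_rationalGaloisRepTate_holds 3) h3 h𝔓]
  exact W.swanConductorAt_rationalTate_eq_swanConductorAt_rationalTate 5 3 _ _ h5 h3 h𝔓

/-! ## The `2`-adic class of the Frey model for `2 ∥ B` -/

/-- `c₄ = 16 (A² + AB + B²)` for the Frey model `y² = x (x − A) (x + B)`
(`b₂ = 4(B − A)`, `b₄ = −2AB`; Silverman *AEC* III.1). [cite: SilvermanAEC2009, III.1] -/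
theorem freyCurve_c₄_eq (A B : ℤ) :
    (freyCurve A B).c₄ = (2 : ℚ) ^ 4 * ((A ^ 2 + A * B + B ^ 2 : ℤ) : ℚ) := by
  simp only [WeierstrassCurve.c₄, WeierstrassCurve.b₂, WeierstrassCurve.b₄, freyCurve_a₁,
    freyCurve_a₂, freyCurve_a₃, freyCurve_a₄]
  push_cast; ring

/-- `c₆ = −32 (B − A)(2A + B)(A + 2B)` for the Frey model `y² = x (x − A) (x + B)`
(`b₂ = 4(B − A)`, `b₄ = −2AB`, `b₆ = 0`; Silverman *AEC* III.1). [cite: SilvermanAEC2009, III.1] -/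
theorem freyCurve_c₆_eq (A B : ℤ) :
    (freyCurve A B).c₆ = -(2 : ℚ) ^ 5 * (((B - A) * (2 * A + B) * (A + 2 * B) : ℤ) : ℚ) := by
  simp only [WeierstrassCurve.c₆, WeierstrassCurve.b₂, WeierstrassCurve.b₄, WeierstrassCurve.b₆,
    freyCurve_a₁, freyCurve_a₂, freyCurve_a₃, freyCurve_a₄, freyCurve_a₆]
  push_cast; ring

/-- **`Sw_𝔓(E[3]) = 3` for the Frey curve with `2 ∥ B`** (Diamond–Kramer 1995, Lemma 2: `f₂ = 5`
for `ord₂ B = 1`).  For `A ≡ −1 (mod 4)`, `B = 2b` with `b` odd, `AB(A+B) ≠ 0`, `2A + B ≠ 0`, every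
place `v ∋ 2` of `𝓞 ℚ` and every prime `𝔓 ∣ v` of `\bar ℤ`.  Write `A = 4α − 1`.  The Frey model has
`c₄ = 2⁴ c₄'`, `c₄' = A² + AB + B²`, and `Δ = 16(AB(A+B))² = 2⁶ (Ab(A+B))²`.  If `b = 4γ + 3` then
`2A + B = 4(2α + 2γ + 1)`, so `c₆ = 2⁷ c₆'` with `c₆' = −(B − A)(2α + 2γ + 1)(A + 2B)` odd and
`c₄' ≡ 7 (mod 8)`: class `(6, 4, 7)`, `swanConductorAt_torsion_three_of_class_D6C4C7M8R7M2R1`.  If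
`b = 4γ + 1` then `2A + B = 8(α + γ) ≠ 0`, so `c₆ = 2⁸ c₆'` with `c₆' = −(B − A)(α + γ)(A + 2B) ≠ 0`
and `c₄' ≡ 3 (mod 8)`: class `(6, 4, ≥ 8)`, `swanConductorAt_torsion_three_of_class_D6C4Cge8M8R3`.
Both tree theorems are the Galois side of Ogg's formula at `2` for their class.
[cite: DiamondKramer1995, Lemma 2] -/
theorem swanConductorAt_torsion_three_freyCurve_of_two_mul {A B : ℤ} (h0 : A * B * (A + B) ≠ 0)
    (hA : A ≡ -1 [ZMOD 4]) {b : ℤ} (hB : B = 2 * b) (hb : Odd b) (h2AB : 2 * A + B ≠ 0)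
    {v : HeightOneSpectrum (𝓞 ℚ)} (hv2 : (2 : 𝓞 ℚ) ∈ v.asIdeal)
    {𝔓 : Ideal (absIntegers (𝓞 ℚ) ℚ)} (h𝔓 : 𝔓 ∈ v.primesAbove) :
    ((freyCurve A B).torsionGaloisRep 3).swanConductorAt (𝓞 ℚ) 𝔓 = 3 := by
  classical
  haveI hE : (freyCurve A B).IsElliptic := isElliptic_freyCurve h0
  obtain ⟨α, hα⟩ : ∃ α : ℤ, A = 4 * α - 1 := ⟨A / 4 + 1, by unfold Int.ModEq at hA; omega⟩
  obtain ⟨β, hβ⟩ := hb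
  have hc4 : (freyCurve A B).c₄ = (2 : ℚ) ^ 4 * ((A ^ 2 + A * B + B ^ 2 : ℤ) : ℚ) :=
    freyCurve_c₄_eq A B
  have hΔ : (freyCurve A B).Δ = (2 : ℚ) ^ 6 * (((A * b * (A + B)) ^ 2 : ℤ) : ℚ) := by
    rw [freyCurve_Δ, hB]; push_cast; ring
  rcases Int.even_or_odd β with ⟨γ, hγ⟩ | ⟨γ, hγ⟩
  · -- `b = 4γ + 1`: class `(6, 4, ≥ 8)`, `c₄' ≡ 3 (mod 8)`
    have hc6 : (freyCurve A B).c₆ =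
        (2 : ℚ) ^ 8 * ((-((B - A) * (α + γ) * (A + 2 * B)) : ℤ) : ℚ) := by
      rw [freyCurve_c₆_eq]
      have e : 2 * A + B = 8 * (α + γ) := by rw [hα, hB, hβ, hγ]; ring
      have e' : ((2 * A + B : ℤ) : ℚ) = ((8 * (α + γ) : ℤ) : ℚ) := by rw [e]
      push_cast at e' ⊢
      linear_combination (-(32 : ℚ)) * ((B : ℚ) - A) * ((A : ℚ) + 2 * B) * e'
    refine swanConductorAt_torsion_three_of_class_D6C4Cge8M8R3 (freyCurve A B) hv2 h𝔓 hc4 hc6 hΔ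
      ?_ ?_
    · have e : A ^ 2 + A * B + B ^ 2 =
          8 * (2 * α ^ 2 + 4 * α * γ + 8 * γ ^ 2 + 3 * γ) + 3 := by
        rw [hα, hB, hβ, hγ]; ring
      rw [e]; omega
    · have h1 : B - A ≠ 0 := by omega
      have h2 : α + γ ≠ 0 := by
        intro h
        apply h2AB
        rw [hα, hB, hβ, hγ]; linear_combination 8 * h
      have h3 : A + 2 * B ≠ 0 := by omega
      exact neg_ne_zero.mpr (mul_ne_zero (mul_ne_zero h1 h2) h3)
  · -- `b = 4γ + 3`: class `(6, 4, 7)`, `c₄' ≡ 7 (mod 8)`, `c₆'` odd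
    have hc6 : (freyCurve A B).c₆ =
        (2 : ℚ) ^ 7 * ((-((B - A) * (2 * α + 2 * γ + 1) * (A + 2 * B)) : ℤ) : ℚ) := by
      rw [freyCurve_c₆_eq]
      have e : 2 * A + B = 4 * (2 * α + 2 * γ + 1) := by rw [hα, hB, hβ, hγ]; ring
      have e' : ((2 * A + B : ℤ) : ℚ) = ((4 * (2 * α + 2 * γ + 1) : ℤ) : ℚ) := by rw [e]
      push_cast at e' ⊢
      linear_combination (-(32 : ℚ)) * ((B : ℚ) - A) * ((A : ℚ) + 2 * B) * e'
    refine swanConductorAt_torsion_three_of_class_D6C4C7M8R7M2R1 (freyCurve A B) hv2 h𝔓 hc4 hc6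
      hΔ ?_ ?_
    · have e : A ^ 2 + A * B + B ^ 2 =
          8 * (2 * α ^ 2 + 4 * α * γ + 2 * α + 8 * γ ^ 2 + 11 * γ + 3) + 7 := by
        rw [hα, hB, hβ, hγ]; ring
      rw [e]; omega
    · have h1 : Odd (B - A) := ⟨4 * γ - 2 * α + 3, by rw [hα, hB, hβ, hγ]; ring⟩
      have h2 : Odd (2 * α + 2 * γ + 1) := ⟨α + γ, by ring⟩
      have h3 : Odd (A + 2 * B) := ⟨2 * α + 8 * γ + 5, by rw [hα, hB, hβ, hγ]; ring⟩
      exact Int.odd_iff.mp ((h1.mul h2).mul h3).neg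

/-! ## The stub -/

/-- **Stub S6 — the Swan conductor of `E[5]` above `2` is odd on the additive Frey classes**
(Diamond–Kramer 1995, Lemma 2, `ord₂ B ∈ {1, 2, 3}`: `f₂ = 5, 3, 3`, i.e. `δ₂ = 3, 1, 1`).  For
coprime `A, B` with `AB(A+B) ≠ 0`, `A ≡ −1 (mod 4)`, `2 ∣ B`, `16 ∤ B` and `2A + B ≠ 0`, there is a
prime `𝔓` of `\bar ℤ` above a place `v ∋ 2` of `𝓞 ℚ` with `Sw_𝔓(E[5]) = 1` or `Sw_𝔓(E[5]) = 3` for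
`E = freyCurve A B`.  Proof: take `v = v₂` the place above `2`; `Sw_𝔓(E[5]) = Sw_𝔓(E[3])`
(`swanConductorAt_torsion_five_eq_swanConductorAt_torsion_three`); if `4 ∣ B` the tree's
`exists_swanConductorAt_torsion_three_freyCurve_of_sixteen_not_dvd` gives a `𝔓 ∣ v₂` with
`Sw_𝔓(E[3]) = 1`; if `4 ∤ B` then `B = 2b`, `b` odd, and
`swanConductorAt_torsion_three_freyCurve_of_two_mul` gives `Sw_𝔓(E[3]) = 3` at any `𝔓 ∣ v₂`
(`primesAbove_nonempty`). [cite: DiamondKramer1995, Lemma 2] -/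
theorem stub_freySwanOdd :
    ∀ (A B : ℤ) [(freyCurve A B).IsElliptic], IsCoprime A B → A * B * (A + B) ≠ 0 →
      A ≡ -1 [ZMOD 4] → (2 : ℤ) ∣ B → ¬ (16 : ℤ) ∣ B → 2 * A + B ≠ 0 →
      ∃ (v : HeightOneSpectrum (𝓞 ℚ)) (𝔓 : Ideal (absIntegers (𝓞 ℚ) ℚ)),
        (2 : 𝓞 ℚ) ∈ v.asIdeal ∧ 𝔓 ∈ v.primesAbove ∧
        (((freyCurve A B).torsionGaloisRep 5).swanConductorAt (𝓞 ℚ) 𝔓 = 1 ∨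
          ((freyCurve A B).torsionGaloisRep 5).swanConductorAt (𝓞 ℚ) 𝔓 = 3) := by
  intro A B _ _ h0 hA h2 h16 h2AB
  have hv2 : (2 : 𝓞 ℚ) ∈
      ((Rat.HeightOneSpectrum.primesEquiv (R := 𝓞 ℚ)).symm ⟨2, Nat.prime_two⟩).asIdeal := by
    have := (Literature.NumberTheory.Automorphic.BCDT.natCast_mem_asIdeal_iff_primesEquiv_eq
      ((Rat.HeightOneSpectrum.primesEquiv (R := 𝓞 ℚ)).symm ⟨2, Nat.prime_two⟩) Nat.prime_two).mpr
      (by rw [Equiv.apply_symm_apply])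
    exact_mod_cast this
  by_cases h4 : (4 : ℤ) ∣ B
  · obtain ⟨𝔓, h𝔓, hSw⟩ :=
      exists_swanConductorAt_torsion_three_freyCurve_of_sixteen_not_dvd h0 hA h4 h16
    exact ⟨_, 𝔓, hv2, h𝔓, Or.inl (by
      rw [swanConductorAt_torsion_five_eq_swanConductorAt_torsion_three _ hv2 h𝔓, hSw])⟩
  · obtain ⟨b, hb⟩ := h2
    have hbodd : Odd b := by
      rcases Int.even_or_odd b with ⟨c, hc⟩ | hodd
      · exact absurd ⟨c, by rw [hb, hc]; ring⟩ h4
      · exact hodd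
    obtain ⟨𝔓, h𝔓⟩ := HeightOneSpectrum.primesAbove_nonempty
      ((Rat.HeightOneSpectrum.primesEquiv (R := 𝓞 ℚ)).symm ⟨2, Nat.prime_two⟩)
    exact ⟨_, 𝔓, hv2, h𝔓, Or.inr (by
      rw [swanConductorAt_torsion_five_eq_swanConductorAt_torsion_three _ hv2 h𝔓]
      exact swanConductorAt_torsion_three_freyCurve_of_two_mul h0 hA hb hbodd h2AB hv2 h𝔓)⟩

end Summit.ABC.ABC.Theorems

end
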